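import Mathlib
import HarnessLib
import HarnessLib.Audit
import Summits.Langlands.Statement
import Summits.Langlands.Langlands.Theses.TameDarkSplit
import Summits.Langlands.Langlands.Theses.ImageOrderLadder

set_option linter.dupNamespace false

open scoped BigOperators Topology Manifold Classical MeasureTheory ProbabilityTheory Matrix InnerProductSpace ComplexConjugate ContinuousMap
open Filter Set Function TopologicalSpace MeasureTheory

/-! # BC3 birth skeleton for `Summit.Langlands.Langlands.Theses.ImageOrderLadder.SmallSolvableArtinAutomorphy` — after-birth form (imports the route file; conclusion = the route decl BY NAME); item stmt-Langlands-28017; stubs stub_orderLE100 stub_orderBand101to107. -/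

namespace Summit.Langlands.Langlands.Cruxes.SmallSolvableArtinAutomorphy.Birth

/-- twist-minimal solvable order ≤ 100 — Wong 2017 Thm 1.2 verbatim («all non-A₅ Galois extensions of degree ≤ 100»), ι-transported -/
theorem stub_orderLE100 :
  ∀ (K : Type) [Field K] [NumberField K], NumberField.IsTotallyReal K → ∀ (n : ℕ) (hcpt : Literature.NumberTheory.Automorphic.isCompact_glFiniteIntegralLevel n K), 0 < n → ∀ (ℓ : ℕ) [Fact ℓ.Prime] (ι : PadicAlgCl ℓ ≃+* ℂ) (ρ : Literature.NumberTheory.GaloisRepresentations.FramedGaloisRep K (PadicAlgCl ℓ) n), ρ.toGaloisRep.IsIrreducible → ((∀ᶠ v : IsDedekindDomain.HeightOneSpectrum (NumberField.RingOfIntegers K) in Filter.cofinite, ρ.IsUnramifiedAt v) ∧ ∀ (v : IsDedekindDomain.HeightOneSpectrum (NumberField.RingOfIntegers K)) (hv : ((ℓ : ℕ) : NumberField.RingOfIntegers K) ∈ v.asIdeal), (Literature.NumberTheory.PAdicHodge.fontainePstAdicCompletion v ℓ hv).IsDeRhamFramed (ρ.toLocal v)) → (Set.range fun g : Field.absoluteGaloisGroup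 K => (ρ g : GL (Fin n) (PadicAlgCl ℓ))).Finite → (∃ χ : Field.absoluteGaloisGroup K →ₜ* (PadicAlgCl ℓ)ˣ, IsSolvable (Literature.NumberTheory.GaloisRepresentations.FramedRep.twist ρ χ).toMonoidHom.range ∧ 0 < Nat.card (Literature.NumberTheory.GaloisRepresentations.FramedRep.twist ρ χ).toMonoidHom.range ∧ Nat.card (Literature.NumberTheory.GaloisRepresentations.FramedRep.twist ρ χ).toMonoidHom.range ≤ 100) → ¬ (∀ (v : IsDedekindDomain.HeightOneSpectrum (NumberField.RingOfIntegers K)) (hv : ((ℓ : ℕ) : NumberField.RingOfIntegers K) ∈ v.asIdeal), ∀ τ : v.adicCompletion K →+* PadicAlgCl ℓ, Continuous τ → (ρ.labelledHodgeTateWeightsAt v (Literature.NumberTheory.PAdicHodge.fontainePstAdicCompletion v ℓ hv).algebra (Literature.NumberTheory.PAdicHodge.fontainePstAdicCompletion v ℓ hv).𝔅 τ).Nodup) → ¬ (n ≤ 4 ∧ (∃ B : Matrix (Fin n) (Fin n) (PadicAlgCl ℓ), B.det ≠ 0 ∧ (Matrix.transpose B = B ∨ Matrix.transpose B = -B) ∧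 (∀ g : Field.absoluteGaloisGroup K, ∃ s : PadicAlgCl ℓ, Matrix.transpose ((ρ g : GL (Fin n) (PadicAlgCl ℓ)) : Matrix (Fin n) (Fin n) (PadicAlgCl ℓ)) * B * ((ρ g : GL (Fin n) (PadicAlgCl ℓ)) : Matrix (Fin n) (Fin n) (PadicAlgCl ℓ)) = s • B) ∧ ∀ (φ : K →+* ℝ) (c : Field.absoluteGaloisGroup K), Literature.NumberTheory.GaloisRepresentations.IsComplexConjugation φ c → Matrix.transpose (B * ((ρ c : GL (Fin n) (PadicAlgCl ℓ)) : Matrix (Fin n) (Fin n) (PadicAlgCl ℓ))) = B * ((ρ c : GL (Fin n) (PadicAlgCl ℓ)) : Matrix (Fin n) (Fin n) (PadicAlgCl ℓ))) ∧ (∀ (v : IsDedekindDomain.HeightOneSpectrum (NumberField.RingOfIntegers K)) (hv : ((ℓ : ℕ) : NumberField.RingOfIntegers K) ∈ v.asIdeal), ∀ τ : v.adicCompletion K →+* PadicAlgCl ℓ, Continuous τ → ∀ w : ℤ, Multiset.count w (ρ.labelledHodgeTateWeightsAt v (Literature.NumberTheory.PAdicHodge.fontainePstAdicCompletion v ℓ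 hv).algebra (Literature.NumberTheory.PAdicHodge.fontainePstAdicCompletion v ℓ hv).𝔅 τ) ≤ 2)) → ¬ (n = 2 ∧ ¬ ρ.IsOdd) → ∃ π : Literature.NumberTheory.Automorphic.CuspidalAutomorphicRepData n K hcpt, π.1.IsLAlgebraic ∧ ∀ᶠ v : IsDedekindDomain.HeightOneSpectrum (NumberField.RingOfIntegers K) in Filter.cofinite, SatakeFrobCompatibleAt ι π.1 ρ v := by
  sorry

/-- twist-minimal solvable order ∈ [101,107]: 101/103/107 cyclic (CFT), 102/105/106 square-free (Wong Cor 6.14), 104 = 8·13 (Wong Cor 6.19) -/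
theorem stub_orderBand101to107 :
  ∀ (K : Type) [Field K] [NumberField K], NumberField.IsTotallyReal K → ∀ (n : ℕ) (hcpt : Literature.NumberTheory.Automorphic.isCompact_glFiniteIntegralLevel n K), 0 < n → ∀ (ℓ : ℕ) [Fact ℓ.Prime] (ι : PadicAlgCl ℓ ≃+* ℂ) (ρ : Literature.NumberTheory.GaloisRepresentations.FramedGaloisRep K (PadicAlgCl ℓ) n), ρ.toGaloisRep.IsIrreducible → ((∀ᶠ v : IsDedekindDomain.HeightOneSpectrum (NumberField.RingOfIntegers K) in Filter.cofinite, ρ.IsUnramifiedAt v) ∧ ∀ (v : IsDedekindDomain.HeightOneSpectrum (NumberField.RingOfIntegers K)) (hv : ((ℓ : ℕ) : NumberField.RingOfIntegers K) ∈ v.asIdeal), (Literature.NumberTheory.PAdicHodge.fontainePstAdicCompletion v ℓ hv).IsDeRhamFramed (ρ.toLocal v)) → (Set.range fun g : Field.absoluteGaloisGroup K => (ρ g : GL (Fin n) (PadicAlgCl ℓ))).Finite → (¬ (∃ χ : Field.absoluteGaloisGroup K →ₜ* (PadicAlgCl ℓ)ˣ, IsSolvable (Literature.NumberTheory.GaloisRepresentations.FramedRep.twist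 ρ χ).toMonoidHom.range ∧ 0 < Nat.card (Literature.NumberTheory.GaloisRepresentations.FramedRep.twist ρ χ).toMonoidHom.range ∧ Nat.card (Literature.NumberTheory.GaloisRepresentations.FramedRep.twist ρ χ).toMonoidHom.range ≤ 100) ∧ (∃ χ : Field.absoluteGaloisGroup K →ₜ* (PadicAlgCl ℓ)ˣ, IsSolvable (Literature.NumberTheory.GaloisRepresentations.FramedRep.twist ρ χ).toMonoidHom.range ∧ 0 < Nat.card (Literature.NumberTheory.GaloisRepresentations.FramedRep.twist ρ χ).toMonoidHom.range ∧ Nat.card (Literature.NumberTheory.GaloisRepresentations.FramedRep.twist ρ χ).toMonoidHom.range ≤ 107)) → ¬ (∀ (v : IsDedekindDomain.HeightOneSpectrum (NumberField.RingOfIntegers K)) (hv : ((ℓ : ℕ) : NumberField.RingOfIntegers K) ∈ v.asIdeal), ∀ τ : v.adicCompletion K →+* PadicAlgCl ℓ, Continuous τ → (ρ.labelledHodgeTateWeightsAt v (Literature.NumberTheory.PAdicHodge.fontainePstAdicCompletion v ℓ hv).algebra (Literature.NumberTheory.PAdicHodge.fontainePstAdicCompletion v ℓ hv).𝔅 τ).Nodup)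 → ¬ (n ≤ 4 ∧ (∃ B : Matrix (Fin n) (Fin n) (PadicAlgCl ℓ), B.det ≠ 0 ∧ (Matrix.transpose B = B ∨ Matrix.transpose B = -B) ∧ (∀ g : Field.absoluteGaloisGroup K, ∃ s : PadicAlgCl ℓ, Matrix.transpose ((ρ g : GL (Fin n) (PadicAlgCl ℓ)) : Matrix (Fin n) (Fin n) (PadicAlgCl ℓ)) * B * ((ρ g : GL (Fin n) (PadicAlgCl ℓ)) : Matrix (Fin n) (Fin n) (PadicAlgCl ℓ)) = s • B) ∧ ∀ (φ : K →+* ℝ) (c : Field.absoluteGaloisGroup K), Literature.NumberTheory.GaloisRepresentations.IsComplexConjugation φ c → Matrix.transpose (B * ((ρ c : GL (Fin n) (PadicAlgCl ℓ)) : Matrix (Fin n) (Fin n) (PadicAlgCl ℓ))) = B * ((ρ c : GL (Fin n) (PadicAlgCl ℓ)) : Matrix (Fin n) (Fin n) (PadicAlgCl ℓ))) ∧ (∀ (v : IsDedekindDomain.HeightOneSpectrum (NumberField.RingOfIntegers K)) (hv : ((ℓ : ℕ) : NumberField.RingOfIntegers K) ∈ v.asIdeal), ∀ τ : v.adicCompletion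 K →+* PadicAlgCl ℓ, Continuous τ → ∀ w : ℤ, Multiset.count w (ρ.labelledHodgeTateWeightsAt v (Literature.NumberTheory.PAdicHodge.fontainePstAdicCompletion v ℓ hv).algebra (Literature.NumberTheory.PAdicHodge.fontainePstAdicCompletion v ℓ hv).𝔅 τ) ≤ 2)) → ¬ (n = 2 ∧ ¬ ρ.IsOdd) → ∃ π : Literature.NumberTheory.Automorphic.CuspidalAutomorphicRepData n K hcpt, π.1.IsLAlgebraic ∧ ∀ᶠ v : IsDedekindDomain.HeightOneSpectrum (NumberField.RingOfIntegers K) in Filter.cofinite, SatakeFrobCompatibleAt ι π.1 ρ v := by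
  sorry

/-- SKELETON PROOF (single closed candidate concluding the route decl BY NAME; writer-1 g7 shape fix of the lens afterbirth `_of`; sorries only inside the two declared stubs): orders ≤ 100 and the band 101–107 ⟹ the cell (excluded middle on the rung-100 hypothesis, inferred by unification). -/
theorem SmallSolvableArtinAutomorphy_proof : Summit.Langlands.Langlands.Theses.ImageOrderLadder.SmallSolvableArtinAutomorphy := by
  have h₁ := stub_orderLE100
  have h₂ := stub_orderBand101to107
  intro K _ _ hK n hcpt hn ℓ _ ι ρ hirr hgeo hfin hcell hnreg hnlim hneven
  refine (Classical.em _).elim (fun h100 => h₁ K hK n hcpt hn ℓ ι ρ hirr hgeo hfin h100 hnreg hnlim hneven) (fun h100 => ?_)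
  exact h₂ K hK n hcpt hn ℓ ι ρ hirr hgeo hfin ⟨h100, hcell⟩ hnreg hnlim hneven

end Summit.Langlands.Langlands.Cruxes.SmallSolvableArtinAutomorphy.Birth
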